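import Summits.QuantumFields.YangMills.Theorems.BalabanUVNodesN07Thm4RecSym152PhiEGOfJunction
import Summits.QuantumFields.YangMills.Theorems.BalabanUVNodesN07Prop8StepCoPGridGOfPremisesG
import HarnessLib

/-!
# N07 [B11] (= [15] = [Balaban1985Variational]) Sect. F — MODULE 134 (P1″-G): **THE REGISTERED K0⁷ STUB 1 `Prop8StepCoPGridGAt F` FROM THE JUNCTION's PER-ρ₀ SUPPLIER AND HSEAM** —
# MODULE 125's collar-uniform premise (P1′-G) packaged over MODULE 133's assembly skeleton: for every collar multiple `ρ₀` (`L^s ∣ ρ₀`), a pre-composed crown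
# `DatumCrownPhiAt F N Mc (ρ₀·L) … s Cr Cω α₁ ω₁` and the per-datum row-9′ supplier `hJ` at `(κ, a₀, Ψ := ψc·(κ·ε_j)²)` with `κ ≤ Aκ·ρ₀` GIVE (P1′-G); with HSEAM they give the stub

Cell `pub-ymgap`, seat `pub-ymgap-dag-n07-e` g32 (FAN-OUT §N07 row s3; LANE OWNER of the K0 road chart side; dag-lead g31 WORDS 248 (2)).  `--kind proof --supports
stmt-QuantumFields-20541 --as helper` (K0⁷; count-neutral).  TWO theorems, 0 `def`.  [15] = [Balaban1985Variational]; [6] = [Balaban1985RegularSpaces]; [III] =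
[Balaban1988Convergent]; [I] = [Balaban1987RG1].

WHY.  The chart side of the K0 road reads: stub 1 ⟸ 125 ((P1′-G) ∧ HSEAM); (P1′-G) = «∃ md ρmin Aκ, ∀ ρ₀ (ρmin ∣ ρ₀), ∃ κ ≤ Aκ·ρ₀, a₀, ψc: HThm4RecSym152PhiEG F 2 Mc (ρ₀·L) (L^md) κ a₀
(ψc·(κ·ε)²)»; 133 gives each family member from the crown and `hJ`.  This file composes the two, so that the junction's closing deliverable is literally the displayed
hypothesis `hsup` below (per ρ₀: constants, the crown — n05-e's F8 head at the collar `ρ₀·L` — and `hJ`), and the chart's remaining premise is HSEAM alone ((ii)-docket).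
`md := s + 1`, `ρmin := L^s` (`L^{s+1} ∣ ρ₀·L`).

WHAT IS PROVED (sorry-free; axioms standard).  ★★ `sym152PhiEG_uniform_of_junction` ((P1′-G) from `hsup`, any `N`); ★★★ `prop8StepCoPGridGAt_of_junction_of_seam` (`N = 2`:
`hsup` ∧ HSEAM ⇒ `K0V22ZDefs.Prop8StepCoPGridGAt F`, by 125 ✓p753627).
HONEST FRAMING: count-neutral composition; `hsup` (crown + `hJ` per ρ₀) and HSEAM are DISPLAYED premises inhabited by nobody; nothing of [15]∕[6]∕[III]∕[I] asserted beyond the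
cited modules; `HThm4RecSym152PhiEG` ∕ `HThm4Rec*` UNDISCHARGED; N05 ∕ N07 NOT discharged; K0⁷ stub 1 is NOT closed by this file (it is its conclusion UNDER `hsup` ∧ HSEAM);
K0⁷ ∕ K1⁹ NOT closed; counts unmoved; R4 closes the conditional finite-𝕋⁴ rung `BalabanLadder.UV` ONLY; the YM mass gap (Clay) is NOT proved; nothing continuum ∕ ℝ⁴ ∕ OS.
No `def`, no `instance`, no `notation`, no `sorry`.

References: [15] (144) p. 300, (147)–(153) p. 301; [6] Thm. 4 p. 88, Prop. 6 pp. 98–99, Prop. 8 p. 100; [III] (2.1)–(2.5) pp. 254–255; [I] (0.1) p. 251, (0.3)–(0.4) pp. 252–253.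
-/

set_option autoImplicit false

noncomputable section

open scoped BigOperators Matrix.Norms.L2Operator

namespace Summit.QuantumFields.YangMills.BalabanUVNodes.N07Prop8StepCoPGridGOfJunction

open Literature.MathematicalPhysics.QuantumFieldTheory.Balaban1983to89
open Literature.MathematicalPhysics.QuantumFieldTheory.Balaban1983to89.Node00
open Literature.MathematicalPhysics.QuantumFieldTheory.Balaban1983to89.B12RegularSpaces111 (gaugeU expI grad)
open B15Eq112TorusCover (cover)
open B14DomainGeom (Pt Within)
open B8Eq131Cubes (box cube tcube tLo tHi)
open B8Eq131CubesRec (tcubeZ bLoZ bHiZ)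
open B6SectAOperatorsV1 (RE dsE)
open B7Prop1Explicit (e gaugeAct)
open B7Prop1Local (AgreeOn InBox)
open B7Prop2SpecialUnitary (specialUnitaryUnits)
open BlockAveragingZd (avgIterZ ctrShift)
open B8Ineq132 (covDerivFwd InAk)
open B8Eq140Level (SideTouches)
open B8Eq138LandauZd (logCfg covLap)
open B8Eq138LandauZdRec (IsLandau138WZ)
open B8Eq119TwistedAxialRec (Restr129Z UnderZ)
open B7SectEFLinearisationRec (logCovIterZ)
open B8Eq184Proof (cfgExp)
open B8ScaledSupNorm (msup bondNorm)
open B8Eq146AExpansion (plaqCovDeriv iEta)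
open B8Eq143PlaqExpansion (pdiv)
open B7AvgGaugeCovariance (uLev)
open MatrixLog (mlog)
open Literature.MathematicalPhysics.QuantumFieldTheory.BalabanImbrieJaffe1984to88.BIJ85AxialPropagator411 (BondSpace)
open T4Continuum (T4Family)
open N07DatumCrownPhiOfRecordCrownPrecomp (DatumCrownPhiAt)
open N07Thm4RecordStructureSym152Phi (NrmSymPhiOfRecord)
open N07Thm4RecordStructureSym152PhiEG (HThm4RecSym152PhiEG)
open N07Thm4RecSym152PhiEGOfJunction (hThm4RecSym152PhiEG_of_junction)
open N07Prop8StepCoPGridGOfPremisesG (prop8StepCoPGridGAt_of_sym152PhiEG_uniform_of_seam)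
open Summit.QuantumFields.YangMills.Theorems.K0V22ZDefs (Prop8StepCoPGridGAt)
open Literature.MathematicalPhysics.QuantumFieldTheory.Balaban1983to89.B15DeterminingSets


variable (F : T4Family) (N : ℕ) [NeZero N]

/-- ★★ **(P1′-G) FROM THE JUNCTION's PER-ρ₀ SUPPLIER**: if for every `ρ₀ ≥ 1` with `L^s ∣ ρ₀` the junction supplies constants `Cr, Cω ≥ 0`, `0 < κ ≤ Aκ·ρ₀`, `0 < a₀`, `0 ≤ ψc`,
`L³·a₀ ≤ α₁`, the pre-composed crown at the collar `ρ₀·L`, and MODULE 133's per-datum hypothesis `hJ` at `Ψ := ψc·(κ·ε_j)²`, then MODULE 125's premise (P1′-G) holds with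
`md := s + 1`, `ρmin := L^s`. [cite: Balaban1985Variational, (144) p.300, (147)–(153) p.301; Balaban1985RegularSpaces, Prop. 6 p.99; Balaban1988Convergent, (2.5) p.255 (bookkeeping)] -/
theorem sym152PhiEG_uniform_of_junction (Mc s : ℕ) {Aκ : ℝ} (hAκ : 0 ≤ Aκ)
    (hsup : ∀ ρ₀ : ℕ, F.L ^ s ∣ ρ₀ → 1 ≤ ρ₀ → ∀ (hρ : F.L ≤ ρ₀ * F.L),
      ∃ Cr Cω α₁ ω₁ κ a₀ ψc : ℝ, 0 ≤ Cr ∧ 0 ≤ Cω ∧ 0 < κ ∧ κ ≤ Aκ * (ρ₀ : ℝ) ∧ 0 < a₀ ∧ 0 ≤ ψc ∧ ( F.L : ℝ) ^ 3 * a₀ ≤ α₁ ∧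
        DatumCrownPhiAt F N Mc (ρ₀ * F.L) hρ s Cr Cω α₁ ω₁ ∧
        (∀ (ν : Stage7Numerics) (M : ℕ) (g : ℕ → ℝ) (K k : ℕ) (sq : SeqOfRecord F ν M g K k), Sect2.SeqSeparated ν.M₁ sq → 0 < ν.M₁ →
          (11 * 4 + 4 * (ρ₀ * F.L) + Mc + 3) * F.L ≤ ν.M₁ → Mc + 11 * 4 + 6 * (ρ₀ * F.L) ≤ (F.P K).sitesPerDir k → 1 ≤ k →
          (∀ i : ℕ, 1 ≤ i → i ≤ k →
            F.L ^ (s + 1) ∣ M * RkOfRecord (F.P K).L ν.r (g i) ∧ dCubeSide (F.P K).L M (RkOfRecord (F.P K).L ν.r (g i)) i ∣ (F.P K).sitesPerDir 0) →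
          ∀ (ε : ℕ → ℝ), (∀ n, n ≤ k → 0 < ε n ∧ ε n ≤ a₀) → (∀ n, n < k → ε n ≤ 2 * ε (n + 1)) →
          ∀ U : GaugeField (F.P K) 0 (SU N),
          (∀ n, n ≤ k → PlaqSmallOn (Sect2.omegaPlaqsTop sq.Ω (suppDomOfRecord F ν K sq.Ω) n) (ε n * (F.P K).eta n ^ 2) U) →
          (∀ n, n ≤ k → Sect2.CoDivSmallOn (Sect2.omegaBondsTop sq.Ω (suppDomOfRecord F ν K sq.Ω) n) (ε n * (F.P K).eta n ^ 3) U) →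
          ∀ (j : ℕ) (hk : j ≤ (F.P K).m + (F.P K).K) (hj1 : 1 ≤ j), j ≤ k → ∀ (idx : Pt (F.P K).d),
          (∃ x ∈ box (F.P K).L (cornerP (F.P K) Mc (ρ₀ * F.L) idx) (sideP (F.P K) Mc (ρ₀ * F.L)) j, ∃ y : Pt (F.P K).d, cover (F.P K) y ∈ sq.Ω j ∧ Within ((3 : ℕ) : ℤ) x y) →
          letI : CStarAlgebra (MatA N) := {};
          -- GIVEN the collar `π(□̃) ⊆ Ω_{j−1}` of the datum …
          cover (F.P K) '' tcube (F.P K).L (cornerP (F.P K) Mc (ρ₀ * F.L) idx) (sideP (F.P K) Mc (ρ₀ * F.L)) (ρ₀ * F.L) j ⊆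
              (if j - 1 = 0 then suppDomOfRecord F ν K sq.Ω else sq.Ω (j - 1)) →
          -- … the non-wrapping of `□̃` and the axial smallness `𝔄_j` at `α := L³·ε_{j−1}` (constant family `□̃ᶻ` AND the dented family) …
          Set.InjOn (cover (F.P K)) (tcube (F.P K).L (cornerP (F.P K) Mc (ρ₀ * F.L) idx) (sideP (F.P K) Mc (ρ₀ * F.L)) (ρ₀ * F.L) j) →
          InAk (F.P K).L j ((F.P K).eta j) (((F.P K).L : ℝ) ^ 3 * ε (j - 1))
              (fun _ => tcubeZ (F.P K).L (cornerP (F.P K) Mc (ρ₀ * F.L) idx) (sideP (F.P K) Mc (ρ₀ * F.L)) (ρ₀ * F.L) j) (fun x μ => ιSU N (U ⟨cover (F.P K) (x + fun _ => (ctrShift (F.P K).L j : ℤ)), μ⟩)) →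
          InAk (F.P K).L j ((F.P K).eta j) (((F.P K).L : ℝ) ^ 3 * ε (j - 1)) (dentFamZ (F.P K) j Mc (ρ₀ * F.L) idx ((domainsOfSeq sq.Ω j hk).Om j)) (fun x μ => ιSU N (U ⟨cover (F.P K) (x + fun _ => (ctrShift (F.P K).L j : ℤ)), μ⟩)) →
          -- … the junction CHOOSES `h`, `X`, `ω` with the crown's input rows and the numerics at `r := Cr·(L³ε_{j−1}) + Cω·ω` …
          ∃ (h : B7Prop1Explicit.Site (F.P K).d → (MatA N)ˣ) (X : ℕ → B7Prop1Explicit.Site (F.P K).d → (MatA N)ˣ) (ω : ℝ),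
            (∀ x, h x ∈ specialUnitaryUnits (Fin N)) ∧ (∀ x, x ∉ (recordCubePZ (F.P K) j hj1 hk Mc (ρ₀ * F.L) hρ idx ((domainsOfSeq sq.Ω j hk).Om j)).sq 0 → h x = 1) ∧
            (∀ j', 1 ≤ j' → j' ≤ j → ∀ y ∈ (recordCubePZ (F.P K) j hj1 hk Mc (ρ₀ * F.L) hρ idx ((domainsOfSeq sq.Ω j hk).Om j)).lamS j', ∀ x, UnderZ (F.P K).L j' y x → h x = X j' y) ∧
            0 ≤ ω ∧ ω ≤ ω₁ ∧
            (∀ j', j' ≤ j → ∀ (z : B7Prop1Explicit.Site (F.P K).d) (μ : Fin (F.P K).d),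
              (∀ x, InBox (fun i => ((F.P K).L : ℤ) ^ j' * z i - (ctrShift (F.P K).L j' : ℤ))
                  (fun i => ((F.P K).L : ℤ) ^ j' * z i + (ctrShift (F.P K).L j' : ℤ) + if i = μ then ((F.P K).L : ℤ) ^ j' else 0) x →
                x ∈ (recordCubePZ (F.P K) j hj1 hk Mc (ρ₀ * F.L) hρ idx ((domainsOfSeq sq.Ω j hk).Om j)).sq (j' - 1)) →
              ‖((uLev (F.P K).L h j' z : (MatA N)ˣ) : MatA N) - ((uLev (F.P K).L h j' (z + e μ) : (MatA N)ˣ) : MatA N)‖ ≤ ω) ∧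
            (∀ b ∈ {b : B7Prop1Explicit.Site (F.P K).d × Fin (F.P K).d | SideTouches ((recordCubePZ (F.P K) j hj1 hk Mc (ρ₀ * F.L) hρ idx ((domainsOfSeq sq.Ω j hk).Om j)).sq 0) b.1 b.2},
              ‖((h b.1 : (MatA N)ˣ) : MatA N) - ((h (b.1 + e b.2) : (MatA N)ˣ) : MatA N)‖ ≤ ω) ∧
            (∀ t : ℝ, 0 ≤ t → t ≤ ((F.P K).L : ℝ) ^ 4 → 2 * ((Cr * (((F.P K).L : ℝ) ^ 3 * ε (j - 1)) + Cω * ω) * t) < κ * ε j) ∧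
            4 * ((N : ℝ) * (Cr * (((F.P K).L : ℝ) ^ 3 * ε (j - 1)) + Cω * ω)) < 2 * Real.pi ∧
            -- … and, for the crown's output `u₀` with ALL its rows (VERBATIM `DatumCrownPhiAt`) and the door's `(u, A)` with the door formula and rows 1–8 + (T2b), SUPPLIES row 9′
            ∀ u₀ : B7Prop1Explicit.Site (F.P K).d → (MatA N)ˣ,
                (∀ x, u₀ x ∈ specialUnitaryUnits (Fin N)) ∧
                  (∀ x, x ∉ (recordCubePZ (F.P K) j hj1 hk Mc (ρ₀ * F.L) hρ idx ((domainsOfSeq sq.Ω j hk).Om j)).sq 0 → u₀ x = 1) ∧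
                  Restr129Z (F.P K).L j (recordCubePZ (F.P K) j hj1 hk Mc (ρ₀ * F.L) hρ idx ((domainsOfSeq sq.Ω j hk).Om j)).lamS (1 : B7Prop1Explicit.Site (F.P K).d → Fin (F.P K).d → (MatA N)ˣ) u₀ ∧
                  IsLandau138WZ (F.P K).L j ((F.P K).eta j) ((recordCubePZ (F.P K) j hj1 hk Mc (ρ₀ * F.L) hρ idx ((domainsOfSeq sq.Ω j hk).Om j)).sq 0) (recordCubePZ (F.P K) j hj1 hk Mc (ρ₀ * F.L) hρ idx ((domainsOfSeq sq.Ω j hk).Om j)).lamS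
                    (1 : B7Prop1Explicit.Site (F.P K).d → Fin (F.P K).d → (MatA N)ˣ)
                    ((recordCubePZ (F.P K) j hj1 hk Mc (ρ₀ * F.L) hρ idx ((domainsOfSeq sq.Ω j hk).Om j)).fixed (fun x μ => ιSU N (U ⟨cover (F.P K) (x + fun _ => (ctrShift (F.P K).L j : ℤ)), μ⟩)) (h⁻¹ * u₀)) ∧
                  (∀ j', j' ≤ j → ∀ b ∈ {b : B7Prop1Explicit.Site (F.P K).d × Fin (F.P K).d | SideTouches ((recordCubePZ (F.P K) j hj1 hk Mc (ρ₀ * F.L) hρ idx ((domainsOfSeq sq.Ω j hk).Om j)).sq j') b.1 b.2},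
                    (recordCubePZ (F.P K) j hj1 hk Mc (ρ₀ * F.L) hρ idx ((domainsOfSeq sq.Ω j hk).Om j)).fixed (fun x μ => ιSU N (U ⟨cover (F.P K) (x + fun _ => (ctrShift (F.P K).L j : ℤ)), μ⟩)) (h⁻¹ * u₀) b.1 b.2 =
                        cfgExp ((F.P K).eta j) (logCfg ((F.P K).eta j) ((recordCubePZ (F.P K) j hj1 hk Mc (ρ₀ * F.L) hρ idx ((domainsOfSeq sq.Ω j hk).Om j)).fixed
                          (fun x μ => ιSU N (U ⟨cover (F.P K) (x + fun _ => (ctrShift (F.P K).L j : ℤ)), μ⟩)) (h⁻¹ * u₀))) b.1 b.2 ∧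
                      IsSelfAdjoint (logCfg ((F.P K).eta j) ((recordCubePZ (F.P K) j hj1 hk Mc (ρ₀ * F.L) hρ idx ((domainsOfSeq sq.Ω j hk).Om j)).fixed
                          (fun x μ => ιSU N (U ⟨cover (F.P K) (x + fun _ => (ctrShift (F.P K).L j : ℤ)), μ⟩)) (h⁻¹ * u₀)) b.1 b.2) ∧
                      ‖logCfg ((F.P K).eta j) ((recordCubePZ (F.P K) j hj1 hk Mc (ρ₀ * F.L) hρ idx ((domainsOfSeq sq.Ω j hk).Om j)).fixed
                          (fun x μ => ιSU N (U ⟨cover (F.P K) (x + fun _ => (ctrShift (F.P K).L j : ℤ)), μ⟩)) (h⁻¹ * u₀)) b.1 b.2‖ ≤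
                        (Cr * (((F.P K).L : ℝ) ^ 3 * ε (j - 1)) + Cω * ω) * (((F.P K).L : ℝ) ^ j' * (F.P K).eta j)⁻¹) ∧
                  (∀ x, (((recordCubePZ (F.P K) j hj1 hk Mc (ρ₀ * F.L) hρ idx ((domainsOfSeq sq.Ω j hk).Om j)).vfix (fun x μ => ιSU N (U ⟨cover (F.P K) (x + fun _ => (ctrShift (F.P K).L j : ℤ)), μ⟩)))⁻¹ * (h⁻¹ * u₀)) x ∈
                    specialUnitaryUnits (Fin N)) ∧
                  AgreeOn (B8Ineq130Rec.tlo (F.P K).L (tLo (cornerP (F.P K) Mc (ρ₀ * F.L) idx) (ρ₀ * F.L)) j) (B8Ineq130Rec.thi (F.P K).L (tHi (cornerP (F.P K) Mc (ρ₀ * F.L) idx) (sideP (F.P K) Mc (ρ₀ * F.L)) (ρ₀ * F.L)) j)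
                    (gaugeAct (((recordCubePZ (F.P K) j hj1 hk Mc (ρ₀ * F.L) hρ idx ((domainsOfSeq sq.Ω j hk).Om j)).vfix (fun x μ => ιSU N (U ⟨cover (F.P K) (x + fun _ => (ctrShift (F.P K).L j : ℤ)), μ⟩)))⁻¹ * (h⁻¹ * u₀))⁻¹
                      (fun x μ => ιSU N (U ⟨cover (F.P K) (x + fun _ => (ctrShift (F.P K).L j : ℤ)), μ⟩)))
                    ((recordCubePZ (F.P K) j hj1 hk Mc (ρ₀ * F.L) hρ idx ((domainsOfSeq sq.Ω j hk).Om j)).fixed (fun x μ => ιSU N (U ⟨cover (F.P K) (x + fun _ => (ctrShift (F.P K).L j : ℤ)), μ⟩)) (h⁻¹ * u₀)) ∧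
                  msup (F.P K).L j ((F.P K).eta j) (-(2 : ℝ))
                      (fun j' (q : Fin (F.P K).d × Fin (F.P K).d × B7Prop1Explicit.Site (F.P K).d) => SideTouches ((recordCubePZ (F.P K) j hj1 hk Mc (ρ₀ * F.L) hρ idx ((domainsOfSeq sq.Ω j hk).Om j)).sq j') q.2.2 q.2.1)
                      (fun q => covDerivFwd ((F.P K).eta j) (1 : B7Prop1Explicit.Site (F.P K).d → Fin (F.P K).d → (MatA N)ˣ) q.1
                        (fun z => (recordCubePZ (F.P K) j hj1 hk Mc (ρ₀ * F.L) hρ idx ((domainsOfSeq sq.Ω j hk).Om j)).expo ((F.P K).eta j)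
                          (fun x μ => ιSU N (U ⟨cover (F.P K) (x + fun _ => (ctrShift (F.P K).L j : ℤ)), μ⟩)) (h⁻¹ * u₀) z q.2.1) q.2.2) ≤ Cr * (((F.P K).L : ℝ) ^ 3 * ε (j - 1)) + Cω * ω ∧
                  bondNorm (F.P K).L j ((F.P K).eta j) (-(3 : ℝ)) (recordCubePZ (F.P K) j hj1 hk Mc (ρ₀ * F.L) hρ idx ((domainsOfSeq sq.Ω j hk).Om j)).sq
                      (fun x μ => pdiv ((F.P K).eta j) (1 : B7Prop1Explicit.Site (F.P K).d → Fin (F.P K).d → (MatA N)ˣ)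
                        (plaqCovDeriv ((F.P K).eta j) (1 : B7Prop1Explicit.Site (F.P K).d → Fin (F.P K).d → (MatA N)ˣ)
                          ((recordCubePZ (F.P K) j hj1 hk Mc (ρ₀ * F.L) hρ idx ((domainsOfSeq sq.Ω j hk).Om j)).expo ((F.P K).eta j)
                            (fun x μ => ιSU N (U ⟨cover (F.P K) (x + fun _ => (ctrShift (F.P K).L j : ℤ)), μ⟩)) (h⁻¹ * u₀))) μ x) ≤ Cr * (((F.P K).L : ℝ) ^ 3 * ε (j - 1)) + Cω * ω ∧
                  bondNorm (F.P K).L j ((F.P K).eta j) (-(3 : ℝ)) (recordCubePZ (F.P K) j hj1 hk Mc (ρ₀ * F.L) hρ idx ((domainsOfSeq sq.Ω j hk).Om j)).sq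
                      (fun x μ => covLap ((F.P K).eta j) (1 : B7Prop1Explicit.Site (F.P K).d → Fin (F.P K).d → (MatA N)ˣ)
                        (fun z => (recordCubePZ (F.P K) j hj1 hk Mc (ρ₀ * F.L) hρ idx ((domainsOfSeq sq.Ω j hk).Om j)).expo ((F.P K).eta j)
                          (fun x μ => ιSU N (U ⟨cover (F.P K) (x + fun _ => (ctrShift (F.P K).L j : ℤ)), μ⟩)) (h⁻¹ * u₀) z μ) x) ≤ Cr * (((F.P K).L : ℝ) ^ 3 * ε (j - 1)) + Cω * ω ∧
                  (∀ (x : B7Prop1Explicit.Site (F.P K).d) (μ : Fin (F.P K).d),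
                    bLoZ (F.P K).L (cornerP (F.P K) Mc (ρ₀ * F.L) idx) 0 0 ≤ x → x + e μ ≤ bHiZ (F.P K).L (cornerP (F.P K) Mc (ρ₀ * F.L) idx) (sideP (F.P K) Mc (ρ₀ * F.L)) 0 0 →
                    (recordCubePZ (F.P K) j hj1 hk Mc (ρ₀ * F.L) hρ idx ((domainsOfSeq sq.Ω j hk).Om j)).inTop x → (recordCubePZ (F.P K) j hj1 hk Mc (ρ₀ * F.L) hρ idx ((domainsOfSeq sq.Ω j hk).Om j)).inTop (x + e μ) →
                    logCovIterZ (F.P K).L (1 : B7Prop1Explicit.Site (F.P K).d → Fin (F.P K).d → (MatA N)ˣ)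
                        (iEta ((F.P K).eta j) ((recordCubePZ (F.P K) j hj1 hk Mc (ρ₀ * F.L) hρ idx ((domainsOfSeq sq.Ω j hk).Om j)).expo ((F.P K).eta j)
                          (fun x μ => ιSU N (U ⟨cover (F.P K) (x + fun _ => (ctrShift (F.P K).L j : ℤ)), μ⟩)) (h⁻¹ * u₀))) j x μ =
                      mlog ((avgIterZ (F.P K).L (gaugeAct h ((recordCubePZ (F.P K) j hj1 hk Mc (ρ₀ * F.L) hρ idx ((domainsOfSeq sq.Ω j hk).Om j)).axial
                        (fun x μ => ιSU N (U ⟨cover (F.P K) (x + fun _ => (ctrShift (F.P K).L j : ℤ)), μ⟩)))) j x μ : (MatA N)ˣ) : MatA N)) →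
            ∀ (u : GaugeTransf (F.P K) 0 (SU N)) (A : PBond (F.P K) 0 → MatA N),
                -- the door formula on `□₀ᶻ`
                (∀ x, x ∈ (recordCubePZ (F.P K) j hj1 hk Mc (ρ₀ * F.L) hρ idx ((domainsOfSeq sq.Ω j hk).Om j)).sq 0 → ιSU N (u (cover (F.P K) (x + fun _ => (ctrShift (F.P K).L j : ℤ)))) = ((h⁻¹ * u₀) x)⁻¹ * (recordCubePZ (F.P K) j hj1 hk Mc (ρ₀ * F.L) hρ idx ((domainsOfSeq sq.Ω j hk).Om j)).vfix (fun x μ => ιSU N (U ⟨cover (F.P K) (x + fun _ => (ctrShift (F.P K).L j : ℤ)), μ⟩)) x) ∧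
                -- rows 1–8 + (T2b) of `HThm4RecSym152PhiEG` for `(u, A)`
                (∀ b ∈ (Sect2.regionOfSet (F.P K) (cover (F.P K) '' box (F.P K).L (cornerP (F.P K) Mc (ρ₀ * F.L) idx) (sideP (F.P K) Mc (ρ₀ * F.L)) j)).bonds,
                  gaugeU (fun x => ιSU N (u x)) (fun b' => ιSU N (U b')) b = expI ((F.P K).eta j) (A b)) ∧
                (∀ b ∈ (Sect2.regionOfSet (F.P K) (cover (F.P K) '' cube (F.P K).L (cornerP (F.P K) Mc (ρ₀ * F.L) idx) (sideP (F.P K) Mc (ρ₀ * F.L)) (ρ₀ * F.L) j 0)).bonds,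
                  gaugeU (fun x => ιSU N (u x)) (fun b' => ιSU N (U b')) b = expI ((F.P K).eta j) (A b)) ∧
                (∀ j', j' ≤ j →
                  ∀ b ∈ (Sect2.regionOfSet (F.P K) (cover (F.P K) '' cube (F.P K).L (cornerP (F.P K) Mc (ρ₀ * F.L) idx) (sideP (F.P K) Mc (ρ₀ * F.L)) (ρ₀ * F.L) j j')).bonds,
                    ‖A b‖ < κ * ε j * ((F.P K).L : ℝ) ^ (j - j')) ∧
                (∀ j', j' ≤ j →
                  ∀ q ∈ (Sect2.regionOfSet (F.P K) (cover (F.P K) '' cube (F.P K).L (cornerP (F.P K) Mc (ρ₀ * F.L) idx) (sideP (F.P K) Mc (ρ₀ * F.L)) (ρ₀ * F.L) j j')).dpairs,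
                    ‖grad ((F.P K).eta j) q.2.1 (fun y => A ⟨y, q.2.2⟩) q.1‖ < κ * ε j * ((F.P K).L : ℝ) ^ (2 * (j - j'))) ∧
                (∀ b ∈ (Sect2.regionOfSet (F.P K) (cover (F.P K) '' box (F.P K).L (cornerP (F.P K) Mc (ρ₀ * F.L) idx) (sideP (F.P K) Mc (ρ₀ * F.L)) j)).bonds,
                  ‖A b‖ < κ * ε j) ∧
                (∀ q ∈ (Sect2.regionOfSet (F.P K) (cover (F.P K) '' box (F.P K).L (cornerP (F.P K) Mc (ρ₀ * F.L) idx) (sideP (F.P K) Mc (ρ₀ * F.L)) j)).dpairs,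
                  ‖grad ((F.P K).eta j) q.2.1 (fun y => A ⟨y, q.2.2⟩) q.1‖ < κ * ε j) ∧
                (∀ b ∈ Sect2.bondsDeep (cover (F.P K) '' box (F.P K).L (cornerP (F.P K) Mc (ρ₀ * F.L) idx) (sideP (F.P K) Mc (ρ₀ * F.L)) j),
                  ‖Sect2.codiffCurlA ((F.P K).eta j) A b.src b.dir‖ < κ * ε j) ∧
                (∀ b ∈ Sect2.bondsDeep (cover (F.P K) '' box (F.P K).L (cornerP (F.P K) Mc (ρ₀ * F.L) idx) (sideP (F.P K) Mc (ρ₀ * F.L)) j),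
                  ‖∑ ν' : Fin (F.P K).d, (((F.P K).eta j : ℝ) : ℂ)⁻¹ •
                      (grad ((F.P K).eta j) ν' (fun y => A ⟨y, b.dir⟩) (b.src.unshift ν') - grad ((F.P K).eta j) ν' (fun y => A ⟨y, b.dir⟩) b.src)‖ < κ * ε j) ∧
                (∀ φ : MatA N →L[ℂ] ℂ,
                  RE (domainsMeet (cubeDomains (F.P K) (cornerP (F.P K) Mc (ρ₀ * F.L) idx) (sideP (F.P K) Mc (ρ₀ * F.L)) (ρ₀ * F.L) j hk) (domainsOfSeq sq.Ω j hk)) ((F.P K).eta j)⁻¹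
                      (dsE ((F.P K).eta j)⁻¹ (WithLp.toLp 2 fun b => (φ (A b)).re : BondSpace (F.P K))) = 0 ∧
                  RE (domainsMeet (cubeDomains (F.P K) (cornerP (F.P K) Mc (ρ₀ * F.L) idx) (sideP (F.P K) Mc (ρ₀ * F.L)) (ρ₀ * F.L) j hk) (domainsOfSeq sq.Ω j hk)) ((F.P K).eta j)⁻¹
                      (dsE ((F.P K).eta j)⁻¹ (WithLp.toLp 2 fun b => (φ (A b)).im : BondSpace (F.P K))) = 0) →
            NrmSymPhiOfRecord F N Mc (ρ₀ * F.L) (ψc * (κ * ε j) ^ 2) ν M g K k sq U j idx u A)) :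
    ∃ md ρmin : ℕ, ∃ Aκ' : ℝ, 1 ≤ ρmin ∧ 0 ≤ Aκ' ∧ ∀ ρ₀ : ℕ, ρmin ∣ ρ₀ → 1 ≤ ρ₀ →
      ∃ κ a₀ ψc : ℝ, 0 < κ ∧ κ ≤ Aκ' * (ρ₀ : ℝ) ∧ 0 < a₀ ∧ 0 ≤ ψc ∧
        HThm4RecSym152PhiEG F N Mc (ρ₀ * F.L) (F.L ^ md) κ a₀ (fun ε j => ψc * (κ * ε j) ^ 2) := by
  refine ⟨s + 1, F.L ^ s, Aκ, Nat.one_le_pow _ _ (F.P 0).L_pos, hAκ, fun ρ₀ hdiv hρ₀ => ?_⟩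
  have hρ : F.L ≤ ρ₀ * F.L := Nat.le_mul_of_pos_left _ hρ₀
  obtain ⟨Cr, Cω, α₁, ω₁, κ, a₀, ψc, hCr, hCω, hκ, hκA, ha₀, hψc, hα, hcrown, hJ⟩ := hsup ρ₀ hdiv hρ₀ hρ
  have hsρ : F.L ^ (s + 1) ∣ ρ₀ * F.L := by rw [pow_succ]; exact mul_dvd_mul hdiv dvd_rfl
  exact ⟨κ, a₀, ψc, hκ, hκA, ha₀, hψc, hThm4RecSym152PhiEG_of_junction F N hρ hCr hCω hcrown hsρ hα hJ⟩

/-- ★★★ **K0⁷ STUB 1 FROM THE JUNCTION's SUPPLIER AND HSEAM** (`N = 2`): `hsup` (per ρ₀: constants, crown, `hJ`) and HSEAM (the (ii)-docket, displayed) give the registered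
`K0V22ZDefs.Prop8StepCoPGridGAt F` — MODULE 125 ✓p753627 over `sym152PhiEG_uniform_of_junction`.  Neither premise is inhabited here.
[cite: Balaban1985RegularSpaces, Prop. 8 p.100, Prop. 6 p.99; Balaban1985Variational, (147)–(153) p.301; Balaban1988Convergent, (2.1)–(2.5) pp.254–255] -/
theorem prop8StepCoPGridGAt_of_junction_of_seam (Mc : ℕ) (hMc : 1 ≤ Mc) (s : ℕ) {Aκ : ℝ} (hAκ : 0 ≤ Aκ)
    (hsup : ∀ ρ₀ : ℕ, F.L ^ s ∣ ρ₀ → 1 ≤ ρ₀ → ∀ (hρ : F.L ≤ ρ₀ * F.L),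
      ∃ Cr Cω α₁ ω₁ κ a₀ ψc : ℝ, 0 ≤ Cr ∧ 0 ≤ Cω ∧ 0 < κ ∧ κ ≤ Aκ * (ρ₀ : ℝ) ∧ 0 < a₀ ∧ 0 ≤ ψc ∧ (F.L : ℝ) ^ 3 * a₀ ≤ α₁ ∧
        DatumCrownPhiAt F 2 Mc (ρ₀ * F.L) hρ s Cr Cω α₁ ω₁ ∧
        (∀ (ν : Stage7Numerics) (M : ℕ) (g : ℕ → ℝ) (K k : ℕ) (sq : SeqOfRecord F ν M g K k), Sect2.SeqSeparated ν.M₁ sq → 0 < ν.M₁ →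
          (11 * 4 + 4 * (ρ₀ * F.L) + Mc + 3) * F.L ≤ ν.M₁ → Mc + 11 * 4 + 6 * (ρ₀ * F.L) ≤ (F.P K).sitesPerDir k → 1 ≤ k →
          (∀ i : ℕ, 1 ≤ i → i ≤ k →
            F.L ^ (s + 1) ∣ M * RkOfRecord (F.P K).L ν.r (g i) ∧ dCubeSide (F.P K).L M (RkOfRecord (F.P K).L ν.r (g i)) i ∣ (F.P K).sitesPerDir 0) →
          ∀ (ε : ℕ → ℝ), (∀ n, n ≤ k → 0 < ε n ∧ ε n ≤ a₀) → (∀ n, n < k → ε n ≤ 2 * ε (n + 1)) →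
          ∀ U : GaugeField (F.P K) 0 (SU 2),
          (∀ n, n ≤ k → PlaqSmallOn (Sect2.omegaPlaqsTop sq.Ω (suppDomOfRecord F ν K sq.Ω) n) (ε n * (F.P K).eta n ^ 2) U) →
          (∀ n, n ≤ k → Sect2.CoDivSmallOn (Sect2.omegaBondsTop sq.Ω (suppDomOfRecord F ν K sq.Ω) n) (ε n * (F.P K).eta n ^ 3) U) →
          ∀ (j : ℕ) (hk : j ≤ (F.P K).m + (F.P K).K) (hj1 : 1 ≤ j), j ≤ k → ∀ (idx : Pt (F.P K).d),
          (∃ x ∈ box (F.P K).L (cornerP (F.P K) Mc (ρ₀ * F.L) idx) (sideP (F.P K) Mc (ρ₀ * F.L)) j, ∃ y : Pt (F.P K).d, cover (F.P K) y ∈ sq.Ω j ∧ Within ((3 : ℕ) : ℤ) x y) →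
          letI : CStarAlgebra (MatA 2) := {};
          -- GIVEN the collar `π(□̃) ⊆ Ω_{j−1}` of the datum …
          cover (F.P K) '' tcube (F.P K).L (cornerP (F.P K) Mc (ρ₀ * F.L) idx) (sideP (F.P K) Mc (ρ₀ * F.L)) (ρ₀ * F.L) j ⊆
              (if j - 1 = 0 then suppDomOfRecord F ν K sq.Ω else sq.Ω (j - 1)) →
          -- … the non-wrapping of `□̃` and the axial smallness `𝔄_j` at `α := L³·ε_{j−1}` (constant family `□̃ᶻ` AND the dented family) …
          Set.InjOn (cover (F.P K)) (tcube (F.P K).L (cornerP (F.P K) Mc (ρ₀ * F.L) idx) (sideP (F.P K) Mc (ρ₀ * F.L)) (ρ₀ * F.L) j) →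
          InAk (F.P K).L j ((F.P K).eta j) (((F.P K).L : ℝ) ^ 3 * ε (j - 1))
              (fun _ => tcubeZ (F.P K).L (cornerP (F.P K) Mc (ρ₀ * F.L) idx) (sideP (F.P K) Mc (ρ₀ * F.L)) (ρ₀ * F.L) j) (fun x μ => ιSU 2 (U ⟨cover (F.P K) (x + fun _ => (ctrShift (F.P K).L j : ℤ)), μ⟩)) →
          InAk (F.P K).L j ((F.P K).eta j) (((F.P K).L : ℝ) ^ 3 * ε (j - 1)) (dentFamZ (F.P K) j Mc (ρ₀ * F.L) idx ((domainsOfSeq sq.Ω j hk).Om j)) (fun x μ => ιSU 2 (U ⟨cover (F.P K) (x + fun _ => (ctrShift (F.P K).L j : ℤ)), μ⟩)) →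
          -- … the junction CHOOSES `h`, `X`, `ω` with the crown's input rows and the numerics at `r := Cr·(L³ε_{j−1}) + Cω·ω` …
          ∃ (h : B7Prop1Explicit.Site (F.P K).d → (MatA 2)ˣ) (X : ℕ → B7Prop1Explicit.Site (F.P K).d → (MatA 2)ˣ) (ω : ℝ),
            (∀ x, h x ∈ specialUnitaryUnits (Fin 2)) ∧ (∀ x, x ∉ (recordCubePZ (F.P K) j hj1 hk Mc (ρ₀ * F.L) hρ idx ((domainsOfSeq sq.Ω j hk).Om j)).sq 0 → h x = 1) ∧
            (∀ j', 1 ≤ j' → j' ≤ j → ∀ y ∈ (recordCubePZ (F.P K) j hj1 hk Mc (ρ₀ * F.L) hρ idx ((domainsOfSeq sq.Ω j hk).Om j)).lamS j', ∀ x, UnderZ (F.P K).L j' y x → h x = X j' y) ∧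
            0 ≤ ω ∧ ω ≤ ω₁ ∧
            (∀ j', j' ≤ j → ∀ (z : B7Prop1Explicit.Site (F.P K).d) (μ : Fin (F.P K).d),
              (∀ x, InBox (fun i => ((F.P K).L : ℤ) ^ j' * z i - (ctrShift (F.P K).L j' : ℤ))
                  (fun i => ((F.P K).L : ℤ) ^ j' * z i + (ctrShift (F.P K).L j' : ℤ) + if i = μ then ((F.P K).L : ℤ) ^ j' else 0) x →
                x ∈ (recordCubePZ (F.P K) j hj1 hk Mc (ρ₀ * F.L) hρ idx ((domainsOfSeq sq.Ω j hk).Om j)).sq (j' - 1)) →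
              ‖((uLev (F.P K).L h j' z : (MatA 2)ˣ) : MatA 2) - ((uLev (F.P K).L h j' (z + e μ) : (MatA 2)ˣ) : MatA 2)‖ ≤ ω) ∧
            (∀ b ∈ {b : B7Prop1Explicit.Site (F.P K).d × Fin (F.P K).d | SideTouches ((recordCubePZ (F.P K) j hj1 hk Mc (ρ₀ * F.L) hρ idx ((domainsOfSeq sq.Ω j hk).Om j)).sq 0) b.1 b.2},
              ‖((h b.1 : (MatA 2)ˣ) : MatA 2) - ((h (b.1 + e b.2) : (MatA 2)ˣ) : MatA 2)‖ ≤ ω) ∧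
            (∀ t : ℝ, 0 ≤ t → t ≤ ((F.P K).L : ℝ) ^ 4 → 2 * ((Cr * (((F.P K).L : ℝ) ^ 3 * ε (j - 1)) + Cω * ω) * t) < κ * ε j) ∧
            4 * (((2 : ℕ) : ℝ) * (Cr * (((F.P K).L : ℝ) ^ 3 * ε (j - 1)) + Cω * ω)) < 2 * Real.pi ∧
            -- … and, for the crown's output `u₀` with ALL its rows (VERBATIM `DatumCrownPhiAt`) and the door's `(u, A)` with the door formula and rows 1–8 + (T2b), SUPPLIES row 9′
            ∀ u₀ : B7Prop1Explicit.Site (F.P K).d → (MatA 2)ˣ,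
                (∀ x, u₀ x ∈ specialUnitaryUnits (Fin 2)) ∧
                  (∀ x, x ∉ (recordCubePZ (F.P K) j hj1 hk Mc (ρ₀ * F.L) hρ idx ((domainsOfSeq sq.Ω j hk).Om j)).sq 0 → u₀ x = 1) ∧
                  Restr129Z (F.P K).L j (recordCubePZ (F.P K) j hj1 hk Mc (ρ₀ * F.L) hρ idx ((domainsOfSeq sq.Ω j hk).Om j)).lamS (1 : B7Prop1Explicit.Site (F.P K).d → Fin (F.P K).d → (MatA 2)ˣ) u₀ ∧
                  IsLandau138WZ (F.P K).L j ((F.P K).eta j) ((recordCubePZ (F.P K) j hj1 hk Mc (ρ₀ * F.L) hρ idx ((domainsOfSeq sq.Ω j hk).Om j)).sq 0) (recordCubePZ (F.P K) j hj1 hk Mc (ρ₀ * F.L) hρ idx ((domainsOfSeq sq.Ω j hk).Om j)).lamS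
                    (1 : B7Prop1Explicit.Site (F.P K).d → Fin (F.P K).d → (MatA 2)ˣ)
                    ((recordCubePZ (F.P K) j hj1 hk Mc (ρ₀ * F.L) hρ idx ((domainsOfSeq sq.Ω j hk).Om j)).fixed (fun x μ => ιSU 2 (U ⟨cover (F.P K) (x + fun _ => (ctrShift (F.P K).L j : ℤ)), μ⟩)) (h⁻¹ * u₀)) ∧
                  (∀ j', j' ≤ j → ∀ b ∈ {b : B7Prop1Explicit.Site (F.P K).d × Fin (F.P K).d | SideTouches ((recordCubePZ (F.P K) j hj1 hk Mc (ρ₀ * F.L) hρ idx ((domainsOfSeq sq.Ω j hk).Om j)).sq j') b.1 b.2},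
                    (recordCubePZ (F.P K) j hj1 hk Mc (ρ₀ * F.L) hρ idx ((domainsOfSeq sq.Ω j hk).Om j)).fixed (fun x μ => ιSU 2 (U ⟨cover (F.P K) (x + fun _ => (ctrShift (F.P K).L j : ℤ)), μ⟩)) (h⁻¹ * u₀) b.1 b.2 =
                        cfgExp ((F.P K).eta j) (logCfg ((F.P K).eta j) ((recordCubePZ (F.P K) j hj1 hk Mc (ρ₀ * F.L) hρ idx ((domainsOfSeq sq.Ω j hk).Om j)).fixed
                          (fun x μ => ιSU 2 (U ⟨cover (F.P K) (x + fun _ => (ctrShift (F.P K).L j : ℤ)), μ⟩)) (h⁻¹ * u₀))) b.1 b.2 ∧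
                      IsSelfAdjoint (logCfg ((F.P K).eta j) ((recordCubePZ (F.P K) j hj1 hk Mc (ρ₀ * F.L) hρ idx ((domainsOfSeq sq.Ω j hk).Om j)).fixed
                          (fun x μ => ιSU 2 (U ⟨cover (F.P K) (x + fun _ => (ctrShift (F.P K).L j : ℤ)), μ⟩)) (h⁻¹ * u₀)) b.1 b.2) ∧
                      ‖logCfg ((F.P K).eta j) ((recordCubePZ (F.P K) j hj1 hk Mc (ρ₀ * F.L) hρ idx ((domainsOfSeq sq.Ω j hk).Om j)).fixed
                          (fun x μ => ιSU 2 (U ⟨cover (F.P K) (x + fun _ => (ctrShift (F.P K).L j : ℤ)), μ⟩)) (h⁻¹ * u₀)) b.1 b.2‖ ≤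
                        (Cr * (((F.P K).L : ℝ) ^ 3 * ε (j - 1)) + Cω * ω) * (((F.P K).L : ℝ) ^ j' * (F.P K).eta j)⁻¹) ∧
                  (∀ x, (((recordCubePZ (F.P K) j hj1 hk Mc (ρ₀ * F.L) hρ idx ((domainsOfSeq sq.Ω j hk).Om j)).vfix (fun x μ => ιSU 2 (U ⟨cover (F.P K) (x + fun _ => (ctrShift (F.P K).L j : ℤ)), μ⟩)))⁻¹ * (h⁻¹ * u₀)) x ∈
                    specialUnitaryUnits (Fin 2)) ∧
                  AgreeOn (B8Ineq130Rec.tlo (F.P K).L (tLo (cornerP (F.P K) Mc (ρ₀ * F.L) idx) (ρ₀ * F.L)) j) (B8Ineq130Rec.thi (F.P K).L (tHi (cornerP (F.P K) Mc (ρ₀ * F.L) idx) (sideP (F.P K) Mc (ρ₀ * F.L)) (ρ₀ * F.L)) j)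
                    (gaugeAct (((recordCubePZ (F.P K) j hj1 hk Mc (ρ₀ * F.L) hρ idx ((domainsOfSeq sq.Ω j hk).Om j)).vfix (fun x μ => ιSU 2 (U ⟨cover (F.P K) (x + fun _ => (ctrShift (F.P K).L j : ℤ)), μ⟩)))⁻¹ * (h⁻¹ * u₀))⁻¹
                      (fun x μ => ιSU 2 (U ⟨cover (F.P K) (x + fun _ => (ctrShift (F.P K).L j : ℤ)), μ⟩)))
                    ((recordCubePZ (F.P K) j hj1 hk Mc (ρ₀ * F.L) hρ idx ((domainsOfSeq sq.Ω j hk).Om j)).fixed (fun x μ => ιSU 2 (U ⟨cover (F.P K) (x + fun _ => (ctrShift (F.P K).L j : ℤ)), μ⟩)) (h⁻¹ * u₀)) ∧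
                  msup (F.P K).L j ((F.P K).eta j) (-(2 : ℝ))
                      (fun j' (q : Fin (F.P K).d × Fin (F.P K).d × B7Prop1Explicit.Site (F.P K).d) => SideTouches ((recordCubePZ (F.P K) j hj1 hk Mc (ρ₀ * F.L) hρ idx ((domainsOfSeq sq.Ω j hk).Om j)).sq j') q.2.2 q.2.1)
                      (fun q => covDerivFwd ((F.P K).eta j) (1 : B7Prop1Explicit.Site (F.P K).d → Fin (F.P K).d → (MatA 2)ˣ) q.1
                        (fun z => (recordCubePZ (F.P K) j hj1 hk Mc (ρ₀ * F.L) hρ idx ((domainsOfSeq sq.Ω j hk).Om j)).expo ((F.P K).eta j)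
                          (fun x μ => ιSU 2 (U ⟨cover (F.P K) (x + fun _ => (ctrShift (F.P K).L j : ℤ)), μ⟩)) (h⁻¹ * u₀) z q.2.1) q.2.2) ≤ Cr * (((F.P K).L : ℝ) ^ 3 * ε (j - 1)) + Cω * ω ∧
                  bondNorm (F.P K).L j ((F.P K).eta j) (-(3 : ℝ)) (recordCubePZ (F.P K) j hj1 hk Mc (ρ₀ * F.L) hρ idx ((domainsOfSeq sq.Ω j hk).Om j)).sq
                      (fun x μ => pdiv ((F.P K).eta j) (1 : B7Prop1Explicit.Site (F.P K).d → Fin (F.P K).d → (MatA 2)ˣ)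
                        (plaqCovDeriv ((F.P K).eta j) (1 : B7Prop1Explicit.Site (F.P K).d → Fin (F.P K).d → (MatA 2)ˣ)
                          ((recordCubePZ (F.P K) j hj1 hk Mc (ρ₀ * F.L) hρ idx ((domainsOfSeq sq.Ω j hk).Om j)).expo ((F.P K).eta j)
                            (fun x μ => ιSU 2 (U ⟨cover (F.P K) (x + fun _ => (ctrShift (F.P K).L j : ℤ)), μ⟩)) (h⁻¹ * u₀))) μ x) ≤ Cr * (((F.P K).L : ℝ) ^ 3 * ε (j - 1)) + Cω * ω ∧
                  bondNorm (F.P K).L j ((F.P K).eta j) (-(3 : ℝ)) (recordCubePZ (F.P K) j hj1 hk Mc (ρ₀ * F.L) hρ idx ((domainsOfSeq sq.Ω j hk).Om j)).sq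
                      (fun x μ => covLap ((F.P K).eta j) (1 : B7Prop1Explicit.Site (F.P K).d → Fin (F.P K).d → (MatA 2)ˣ)
                        (fun z => (recordCubePZ (F.P K) j hj1 hk Mc (ρ₀ * F.L) hρ idx ((domainsOfSeq sq.Ω j hk).Om j)).expo ((F.P K).eta j)
                          (fun x μ => ιSU 2 (U ⟨cover (F.P K) (x + fun _ => (ctrShift (F.P K).L j : ℤ)), μ⟩)) (h⁻¹ * u₀) z μ) x) ≤ Cr * (((F.P K).L : ℝ) ^ 3 * ε (j - 1)) + Cω * ω ∧
                  (∀ (x : B7Prop1Explicit.Site (F.P K).d) (μ : Fin (F.P K).d),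
                    bLoZ (F.P K).L (cornerP (F.P K) Mc (ρ₀ * F.L) idx) 0 0 ≤ x → x + e μ ≤ bHiZ (F.P K).L (cornerP (F.P K) Mc (ρ₀ * F.L) idx) (sideP (F.P K) Mc (ρ₀ * F.L)) 0 0 →
                    (recordCubePZ (F.P K) j hj1 hk Mc (ρ₀ * F.L) hρ idx ((domainsOfSeq sq.Ω j hk).Om j)).inTop x → (recordCubePZ (F.P K) j hj1 hk Mc (ρ₀ * F.L) hρ idx ((domainsOfSeq sq.Ω j hk).Om j)).inTop (x + e μ) →
                    logCovIterZ (F.P K).L (1 : B7Prop1Explicit.Site (F.P K).d → Fin (F.P K).d → (MatA 2)ˣ)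
                        (iEta ((F.P K).eta j) ((recordCubePZ (F.P K) j hj1 hk Mc (ρ₀ * F.L) hρ idx ((domainsOfSeq sq.Ω j hk).Om j)).expo ((F.P K).eta j)
                          (fun x μ => ιSU 2 (U ⟨cover (F.P K) (x + fun _ => (ctrShift (F.P K).L j : ℤ)), μ⟩)) (h⁻¹ * u₀))) j x μ =
                      mlog ((avgIterZ (F.P K).L (gaugeAct h ((recordCubePZ (F.P K) j hj1 hk Mc (ρ₀ * F.L) hρ idx ((domainsOfSeq sq.Ω j hk).Om j)).axial
                        (fun x μ => ιSU 2 (U ⟨cover (F.P K) (x + fun _ => (ctrShift (F.P K).L j : ℤ)), μ⟩)))) j x μ : (MatA 2)ˣ) : MatA 2)) →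
            ∀ (u : GaugeTransf (F.P K) 0 (SU 2)) (A : PBond (F.P K) 0 → MatA 2),
                -- the door formula on `□₀ᶻ`
                (∀ x, x ∈ (recordCubePZ (F.P K) j hj1 hk Mc (ρ₀ * F.L) hρ idx ((domainsOfSeq sq.Ω j hk).Om j)).sq 0 → ιSU 2 (u (cover (F.P K) (x + fun _ => (ctrShift (F.P K).L j : ℤ)))) = ((h⁻¹ * u₀) x)⁻¹ * (recordCubePZ (F.P K) j hj1 hk Mc (ρ₀ * F.L) hρ idx ((domainsOfSeq sq.Ω j hk).Om j)).vfix (fun x μ => ιSU 2 (U ⟨cover (F.P K) (x + fun _ => (ctrShift (F.P K).L j : ℤ)), μ⟩)) x) ∧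
                -- rows 1–8 + (T2b) of `HThm4RecSym152PhiEG` for `(u, A)`
                (∀ b ∈ (Sect2.regionOfSet (F.P K) (cover (F.P K) '' box (F.P K).L (cornerP (F.P K) Mc (ρ₀ * F.L) idx) (sideP (F.P K) Mc (ρ₀ * F.L)) j)).bonds,
                  gaugeU (fun x => ιSU 2 (u x)) (fun b' => ιSU 2 (U b')) b = expI ((F.P K).eta j) (A b)) ∧
                (∀ b ∈ (Sect2.regionOfSet (F.P K) (cover (F.P K) '' cube (F.P K).L (cornerP (F.P K) Mc (ρ₀ * F.L) idx) (sideP (F.P K) Mc (ρ₀ * F.L)) (ρ₀ * F.L) j 0)).bonds,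
                  gaugeU (fun x => ιSU 2 (u x)) (fun b' => ιSU 2 (U b')) b = expI ((F.P K).eta j) (A b)) ∧
                (∀ j', j' ≤ j →
                  ∀ b ∈ (Sect2.regionOfSet (F.P K) (cover (F.P K) '' cube (F.P K).L (cornerP (F.P K) Mc (ρ₀ * F.L) idx) (sideP (F.P K) Mc (ρ₀ * F.L)) (ρ₀ * F.L) j j')).bonds,
                    ‖A b‖ < κ * ε j * ((F.P K).L : ℝ) ^ (j - j')) ∧
                (∀ j', j' ≤ j →
                  ∀ q ∈ (Sect2.regionOfSet (F.P K) (cover (F.P K) '' cube (F.P K).L (cornerP (F.P K) Mc (ρ₀ * F.L) idx) (sideP (F.P K) Mc (ρ₀ * F.L)) (ρ₀ * F.L) j j')).dpairs,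
                    ‖grad ((F.P K).eta j) q.2.1 (fun y => A ⟨y, q.2.2⟩) q.1‖ < κ * ε j * ((F.P K).L : ℝ) ^ (2 * (j - j'))) ∧
                (∀ b ∈ (Sect2.regionOfSet (F.P K) (cover (F.P K) '' box (F.P K).L (cornerP (F.P K) Mc (ρ₀ * F.L) idx) (sideP (F.P K) Mc (ρ₀ * F.L)) j)).bonds,
                  ‖A b‖ < κ * ε j) ∧
                (∀ q ∈ (Sect2.regionOfSet (F.P K) (cover (F.P K) '' box (F.P K).L (cornerP (F.P K) Mc (ρ₀ * F.L) idx) (sideP (F.P K) Mc (ρ₀ * F.L)) j)).dpairs,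
                  ‖grad ((F.P K).eta j) q.2.1 (fun y => A ⟨y, q.2.2⟩) q.1‖ < κ * ε j) ∧
                (∀ b ∈ Sect2.bondsDeep (cover (F.P K) '' box (F.P K).L (cornerP (F.P K) Mc (ρ₀ * F.L) idx) (sideP (F.P K) Mc (ρ₀ * F.L)) j),
                  ‖Sect2.codiffCurlA ((F.P K).eta j) A b.src b.dir‖ < κ * ε j) ∧
                (∀ b ∈ Sect2.bondsDeep (cover (F.P K) '' box (F.P K).L (cornerP (F.P K) Mc (ρ₀ * F.L) idx) (sideP (F.P K) Mc (ρ₀ * F.L)) j),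
                  ‖∑ ν' : Fin (F.P K).d, (((F.P K).eta j : ℝ) : ℂ)⁻¹ •
                      (grad ((F.P K).eta j) ν' (fun y => A ⟨y, b.dir⟩) (b.src.unshift ν') - grad ((F.P K).eta j) ν' (fun y => A ⟨y, b.dir⟩) b.src)‖ < κ * ε j) ∧
                (∀ φ : MatA 2 →L[ℂ] ℂ,
                  RE (domainsMeet (cubeDomains (F.P K) (cornerP (F.P K) Mc (ρ₀ * F.L) idx) (sideP (F.P K) Mc (ρ₀ * F.L)) (ρ₀ * F.L) j hk) (domainsOfSeq sq.Ω j hk)) ((F.P K).eta j)⁻¹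
                      (dsE ((F.P K).eta j)⁻¹ (WithLp.toLp 2 fun b => (φ (A b)).re : BondSpace (F.P K))) = 0 ∧
                  RE (domainsMeet (cubeDomains (F.P K) (cornerP (F.P K) Mc (ρ₀ * F.L) idx) (sideP (F.P K) Mc (ρ₀ * F.L)) (ρ₀ * F.L) j hk) (domainsOfSeq sq.Ω j hk)) ((F.P K).eta j)⁻¹
                      (dsE ((F.P K).eta j)⁻¹ (WithLp.toLp 2 fun b => (φ (A b)).im : BondSpace (F.P K))) = 0) →
            NrmSymPhiOfRecord F 2 Mc (ρ₀ * F.L) (ψc * (κ * ε j) ^ 2) ν M g K k sq U j idx u A))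
    (hseam : ∀ (Adm : StepGuard F), ∀ (ν : Stage7Numerics) (M : ℕ) (g : ℕ → ℝ) (K k : ℕ) (s : SeqOfRecord F ν M g K k), Sect2.SeqSeparated ν.M₁ s → 0 < ν.M₁ →
        Adm ν M g K k s → 1 ≤ k →
        ∀ (δ : ℕ → ℝ),
        ∀ W : MSField (F.P K) (SU 2), Sect2.DataSmall7PTop (avOfRecord F 2 K) s.Ω (suppDomOfRecord F ν K s.Ω) k δ W →
        ∀ U : GaugeField (F.P K) 0 (SU 2),
        AgreeOn (genSet s.Ω k) (avgFamily (avOfRecord F 2 K) U) W → IsCritOnFibre F 2 K (genSet s.Ω k) W U →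
        ∀ (hkk : k ≤ (F.P K).m + (F.P K).K),
        ∀ γ : ℝ → GaugeField (F.P K) 0 (SU 2), γ 0 = U →
          DifferentiableAt ℝ (fun (t : ℝ) (b : PBond (F.P K) 0) => ((γ t b : SU 2) : Matrix (Fin 2) (Fin 2) ℂ)) 0 →
            (∀ᶠ t in nhds (0 : ℝ), ∀ (j : ℕ) (c : PBond (F.P K) j), (domainsOfSeq s.Ω k hkk).LamBond j c →
              avgFamily (avOfRecord F 2 K) (γ t) j c = W j c) →
              ∀ a : ℝ, HasDerivAt (fun t => wilsonAction4 (γ t)) a 0 → a = 0) :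
    Prop8StepCoPGridGAt F :=
  prop8StepCoPGridGAt_of_sym152PhiEG_uniform_of_seam F Mc hMc (sym152PhiEG_uniform_of_junction F 2 Mc s hAκ hsup) hseam

end Summit.QuantumFields.YangMills.BalabanUVNodes.N07Prop8StepCoPGridGOfJunction

end
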